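import Mathlib.Analysis.InnerProductSpace.l2Space
import Mathlib.Analysis.Distribution.SchwartzSpace.Basic
import Literature.NumberTheory.LFunctions.ProlateExistsUnique
import Literature.NumberTheory.ConnesConsani2021.MainInequalityAssembly
import Literature.NumberTheory.ConnesConsani2021.ScalingOperator
import HarnessLib

/-!
# Connes–Consani 2021, Theorem 4.7: the archimedean trace formula `Tr(ϑ(f)𝐒) = W_∞(f) + ∫ f(ρ⁻¹)ε(ρ)d*ρ`
# (the function `ε`), and App. D Lemma D.1 (the quantized differential is of infinite order) — STATEMENTS

RH-FREE corpus literature (cell `rh-crit`, sub-cell cc, seat t4; bears_on: LADDER-RH W-C/W-P, apex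
input (A) `hTr`).  WHAT THIS IS NOT: any claim about RH; positivity at the archimedean place alone
never reaches the critical strip; formalising this corpus fixes WHICH inequality would prove RH, it
does not move RH.  Nothing in this file bears on the truth of RH.

A. Connes, C. Consani, *Weil positivity and trace formula, the archimedean place*, Selecta Math.
(N.S.) 27 (2021), Paper No. 77 = arXiv:2006.13771 [bib: `ConnesConsani2021`].  Journal numbering
(dictionary `pub-rhdoor/CC-MAP.md` §3): Prop. 4.5 = arXiv item Prop. 25, Rem. 4.6 = Rem. 26,
**Thm. 4.7 = Thm. 27** (§4 p. 18; arXiv chunk p0018:L33–40, proof L42–87), Lemma 5.4 = Lemma 31;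
App. D «Quantized calculus redux», **Lemma D.1 = arXiv Lemma 47** (p0033:L22, proof L24–36),
Rem. D.2 = arXiv Rem. 48 (p0033:L38–41); App. E «Signs and normalizations», eq. (quantdiff)
(p0034:L21–22); App. F «Issues of convergence», Lemma F.1 = arXiv Lemma 49.  (Appendix letters per the
cell dictionary `cc/CC2021-NUMBERING-lit-1.md`, checked against the TeX of record: A Fourier vs Mellin,
B Explicit formula, C Positivity criterion, D Quantized calculus redux, E Signs and normalizations,
F Issues of convergence, G Numerical values.)  Below "Lemma D.1 (47)" / "Rem. D.2 (48)" name both.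

## What is printed

**Theorem 4.7.** "Let `𝐒` be the orthogonal projection of `L²(ℝ)_ev` on the closed subspace
`S(1,1)`.  The following functional is positive
`Tr(ϑ(f)𝐒) = W_∞(f) + ∫ f(ρ⁻¹)ε(ρ) d*ρ`, `f ∈ C_c^∞(ℝ₊*)`,                                (sonine0)
where `W_∞` is as in (sch22), `ε(ρ)` is the function of `ρ ∈ ℝ₊*`, with `ε(ρ⁻¹) = ε(ρ)`, which is
given, for `ρ ≥ 1`, by `ε(ρ) = Σ_n λ(n)(1 − λ(n)²)^{-1/2} ⟨ξ_n | ϑ(ρ⁻¹) ζ_n⟩`."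
Here (Prop. 4.5, p0016:L50–p0017:L63): `ξ_n = 𝒫₁φ_n/‖𝒫₁φ_n‖` is the unit vector of `L²(ℝ)_ev` obtained by
restricting the even prolate spheroidal wave function `PS_{2n,0}(2π, x)` to `[−1, 1]`, `λ(n)` its
eigenvalue for the truncated Fourier transform ((prolateeq), p0016:L19–21:
`∫_{−1}^{1} PS_{2n,0}(2π,x) e^{i2πxω} dx = λ(n) PS_{2n,0}(2π,ω)`; `λ(0) = 0.999971`,
`λ(1) = −0.979485`, …), `η_n = 𝔽_{e_ℝ} ξ_n`, `ψ_n = P η_n` (`P` = multiplication by `1_{|x| ≥ 1}`),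
`‖ψ_n‖ = (1 − λ(n)²)^{1/2}`, `ζ_n = (1 − λ(n)²)^{-1/2} ψ_n`, `τ(n) = λ(n)(1 − λ(n)²)^{-1/2}`, and
`(ϑ(λ)ξ)(v) = λ^{-1/2} ξ(λ^{-1}v)` (Greek letters as in the TeX source, ll. 1029–1139, checked by
seat t3: `η_n = 𝔽ξ_n`, `ζ_n` the normalised cut vector; seat t3's `ProlateProjections.lean` has
`prolateEigen n = prolateLambda (prolateFun n)` and `prolatePsiFun n = prolateCutFourier (prolateFun n)`,
both `rfl`).  In the proof (p0018:L55–70) the `n`-th term of `ε` is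
`T_n = τ(n)⟨ξ_n|ϑ(ρ⁻¹)ζ_n⟩`, the companion term `⟨ζ_n|ϑ(ρ⁻¹)ξ_n⟩` vanishing for `ρ ≥ 1` by
Rem. 4.6 (ii) (sym1) (disjoint supports).  Proof of Lemma 5.4 (p0020:L89–93): with
`η_n = λ(n) ξ_n^{an}` (the Fourier transform of the truncated prolate function is `λ(n)` times its
analytic continuation), `ε(ρ) = Σ_n λ(n)²(1 − λ(n)²)⁻¹ ρ^{1/2} ∫_{ρ⁻¹}^{1} ξ_n^{an}(x) ξ_n^{an}(ρx) dx`.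

**Lemma D.1 (App. D; arXiv Lemma 47).** "For `f ∈ 𝒮(Ĉ)` the quantized differential `[H, f]` is an infinitesimal of
infinite order and in particular a trace class operator" — `H = 2𝔽_C 1_P 𝔽_C⁻¹ − 1` on `L²(Ĉ)`,
`C = ℝ₊*`, `Ĉ ≅ ℝ`, `f` acting by multiplication; "a compact operator has infinite order when its
characteristic values form a sequence of rapid decay; this implies that it is of trace class"
(p0033:L20, citing [Co-book] Ch. IV).  App. E (p0034:L21–22): "The quantized differential `đf` of
`f` is given by the kernel `k(s,t) = (i/π)(f(s) − f(t))/(s − t)`" — the formulation used by the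
second alternate proof of Rem. D.2 (48) (p0033:L39–41).

## How it is typed (design)

* **The prolate data, function-level and (prolateeq)-free.**  The tree's prolate interface is
  `Literature.NumberTheory.LFunctions.IsProlateFunction lam n f` (file `ConnesProlateGuess.lean`;
  for `lam = 1` the operator `−∂(1 − x²)∂ + (2πx)²` is exactly CC's `𝐖` of p0016:L4–7, bandwidth
  `c = 2π`), with `∫_{−1}^{1} f² = 1`, `f = 0` outside `[−1,1]`, `f(0) > 0`; existence and uniqueness
  for even index is the tree theorem `existsUnique_isProlateFunction_holds`, evenness is
  `IsProlateFunction.even`.  Statements are quantified over a family `ψ : ℕ → ℝ → ℝ` with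
  `∀ n, IsProlateFunction 1 (2n) (ψ n)` — the idiom of `prolateGuess_tendsto_riemannXi` — so nothing
  is chosen and nothing is smuggled (`prolateFamily_unique`: there is one such family).  CC's `ξ_n`
  (unit vector for `⟨ξ|η⟩ = ½∫_ℝ ξ̄η`, eq. (8) p. 7) is `√2 · ψ_n`; since every term of `ε` is
  quadratic in `ξ_n` and CC's inner product carries the factor `½`, the two normalisations give the
  same number (sign of `ψ_n` immaterial).  We define `λ(n)` by reading (prolateeq) at `ω = 0`:
  `prolateLambda φ = (∫ φ)/φ(0)`, and CC's `ψ_n = P𝔽_{e_ℝ}ξ_n` as `prolateCutFourier φ =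
  1_{|v| ≥ 1} · 𝓕(φ)` (Mathlib's `𝓕`, kernel `e^{−2πixy}` = eq. (13) p. 7).  The identification of
  `prolateLambda` with the truncated-Fourier eigenvalue IS (prolateeq) (Slepian's commutation — not
  in the tree) and is not asserted here.  These shapes are the ones fixed with the route planner
  (cc/STATUS 2026-08-26T02:03:42Z, items K0–K3).
* **`ε` and the density.**  The `n`-th term of (sonine0) is `τ(n)⟨ξ_n|ϑ(ρ⁻¹)ζ_n⟩ =
  λ(n)(1 − λ(n)²)⁻¹⟨ξ_n|ϑ(ρ⁻¹)ψ_n⟩` (`ζ_n = (1 − λ²)^{-1/2}ψ_n`); with the tree's matrix coefficient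
  `scalingCoeff ξ η τ = ⟨ξ|ϑ(e^τ)η⟩ = ∫ ξ̄(v) e^{−τ/2} η(e^{−τ}v) dv` (`ArchimedeanSoninTrace.lean`) at
  `τ = −y`, `ρ = e^{y}`, this is `epsTerm (ψ n) y`; `epsDensity ψ y := Σ'_n epsTerm (ψ n) |y| =
  ε(e^{|y|})` (the `|y|` implements `ε(ρ⁻¹) = ε(ρ)`), `ccEpsilon ψ ρ := epsDensity ψ (log ρ) = ε(ρ)`
  (`ccEpsilon_inv`, `ccEpsilon_of_one_le`: for `ρ ≥ 1` literally (sonine0)).  Complex-valued as typed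
  (real in print).  The series converges (App. F Lemma F.1 (49), typed by seat t6); Mathlib's `tsum`
  convention is immaterial there.  CC's `E(f) = ∫ f(ρ⁻¹)ε(ρ)d*ρ = ∫_ℝ F(x) ε(e^{|x|}) dx` (`F = f ∘ exp`
  the additive avatar, `d*ρ = dx`, symmetry of `ε`) is the tree's `evenFunctional (epsDensity ψ) F`
  (`JumpFormula.lean`: `evenFunctional G f = ∫ f(x) G(|x|) dx`).  `epsDensity ψ` is CC's `ε ∘ exp`,
  the `G` of (H-ε) in `MainInequalityAssembly.lean` ON `[0, ∞)`; it is NOT `C²` at `0` on `ℝ`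
  (`ε′(1₊) ≃ 22.9965 ≠ 0`, Lemma 5.4), the assembly only reads `G` on `[0,∞)`, so the corpus items are
  stated over the predicate `IsArchDensity G` ("`G = ε ∘ exp` on `[0,∞)`", non-vacuous:
  `isArchDensity_epsDensity`), any `C²` such `G` being admissible (`hTr_of_thm_4_7_weak`).
* **The trace.**  As in `ArchimedeanSoninTrace.lean` ("How the trace is typed"): Mathlib has no
  trace class on `L²(ℝ)`; `ϑ(f)𝐒` is trace class in print (Prop. 2.2 (iii) proof p0010:L74–76 with
  Lemma D.1 (47), and `P𝒫̂P − 𝐒 = Σ λ(n)²|ζ_n⟩⟨ζ_n|`, p0017:L61), so `Tr(ϑ(f)𝐒) = Tr(𝐒ϑ(f)𝐒) =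
  Σ_i ⟨e_i|ϑ(f)e_i⟩` for EVERY orthonormal basis `(e_i)` of `S(1,1)`, the series converging
  (absolutely).  The ½-normalisation of CC's inner product does not change traces.  Hence the
  STRONG form `CC2021_thm_4_7`: for every Hilbert basis `b` of the tree's `soninSpace 1 1`,
  `HasSum (i ↦ soninTraceForm F (b i)) (archW F + evenFunctional (epsDensity ψ) F)`, plus the
  printed positivity clause on `F = g ∗ g*`.  The WEAK form `CC2021_thm_4_7_weak` is the shape
  consumed by `MainInequalityAssembly` (hypothesis (H-TF), lines 336–341 at current bytes; route item
  K1 `SoninTraceFormula`): for every archimedean density `G` and `f = g ∗ g*`, every finite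
  orthonormal family in `S(1,1)` has `Σ_i Re⟨ξ_i|ϑ(f)ξ_i⟩ ≤ Re W_∞(f) + Re E(f)` (partial sums of the
  trace of the positive operator `𝐒ϑ(g)ϑ(g)*𝐒`); `weilArchPositivity_soninTrace_fine_of_thm_4_7_weak`
  (`…_of_opIneq`) and `weilArchPositivity_soninTrace_of_thm_4_7_weak` are the kernel-checked
  compositions with the assembly (eq. (4) / Thm. 1 from (A) this fact + (B) + (C)).  WEAK ⇐ STRONG is
  PROVED (`CC2021_thm_4_7_weak_of_thm_4_7`): `Re⟨ξ|ϑ(g ∗ g*)ξ⟩ = ‖ϑ(g)*ξ‖² ≥ 0` (tree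
  `ScalingOperator.lean`) and partial sums over orthonormal families of the closed subspace `S(1,1)` are
  bounded by the sum over any Hilbert basis (tree `HilbertSchmidtPartialSums.lean`); so the weak form
  is a named `Prop` only because it is the shape of route item K1 — its content is Theorem 4.7's
  (FACT-LIST: `_weak ⇐ _4_7`, proved).
* **App. D.**  Minimal s-number vocabulary (Pietsch approximation numbers `a_n(T) = inf{‖T − F‖ :
  rank F ≤ n}`, which on Hilbert space are the singular values [folklore: Gohberg–Krein Ch. II §2,
  Allakhverdiev]): `approxNumber`, `IsInfiniteOrder` (`a_n = O(n^{−k})` for all `k`),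
  `IsTraceClass` (`Σ a_n < ∞`); `IsInfiniteOrder → IsTraceClass` is PROVED.  Lemma D.1 (47) is typed on
  the kernel of App. E (quantdiff): `quantizedDiffKernel f s t = (i/π)(f(s) − f(t))/(s − t)` is
  square integrable and every bounded operator on `L²(ℝ)` with this kernel is of infinite order
  (the tree's kernel-operator idiom of `Literature.Analysis.OperatorTheory.exists_l2KernelOp`: no
  operator is chosen).  Rem. D.2 (48) (two alternate proofs: conformal map to `L²(S¹)` and `P_{H²}`;
  direct kernel estimate) has no statement content beyond this kernel and is recorded here only.

## Deliberately NOT here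

The operators `P`, `𝒫̂₁`, the angle operator and Prop. 4.5 / Rem. 4.6 themselves (seat t3, file
`ProlateProjections.lean`, stated over the definitions below); Prop. 5.3 / Lemma 5.4 / App. E on
`Qε`, `ε′(1₊)` and convergence (seats t5/t6); §2's `δ`, `L`, `W_∞ = L − D` (seat t1); any numerics.
Connes' *Letter* (arXiv:2602.04022) §7: its Thm. 7.1 (p0024:L29) is CC 2021 **Thm. 1** = the tree's
`WeilArchPositivity_soninTrace` (not Thm. 4.7), and its "archimedean trace formula" is the
unnumbered display of §7.1 (`W_∞(f) = log(TW) f(1) + Tr(ϑ(f)(1 − P_T − 𝒫̂_W))`, Connes 1999), of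
which Thm. 4.7 is the Sonin-space refinement; no alias is declared here.  This file introduces two
named facts (`CC2021_thm_4_7`, `CC2021_thm_4_7_weak`) and one for App. D (`CC2021_lemma_D47`),
discharges none, and makes no RH claim.
-/

noncomputable section

open _root_.MeasureTheory Complex Set Filter FourierTransform
open scoped Real ComplexConjugate InnerProductSpace Topology

namespace Literature.NumberTheory.ConnesConsani2021

open Literature.NumberTheory.LFunctions

/-! ## §4 prolate data of Prop. 4.5, function-level (CC's `λ(n)` and `ψ_n = P𝔽_{e_ℝ}ξ_n`) -/

/-- RH-FREE. CC's eigenvalue `λ(n)` of the truncated Fourier transform on the `n`-th even prolate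
function, read off (prolateeq) at `ω = 0`: `∫_{−1}^{1} PS_{2n,0}(2π,x) dx = λ(n) PS_{2n,0}(2π, 0)`, i.e.
`λ(n) = (∫ φ)/φ(0)` for `φ` the prolate function extended by `0` outside `[−1,1]` (any normalisation;
`φ(0) ≠ 0` for even index, `IsProlateFunction.pos_zero`).  Printed values `λ(0) = 0.999971,
λ(1) = −0.979485, λ(2) = 0.524086, …` (p0016:L22–23); `|λ(n)| < 1` (a nonzero function and its
Fourier transform are not both supported in `[−1,1]`).  That this number is the eigenvalue of
`𝒫₁𝔽_{e_ℝ}𝒫₁` is (prolateeq) = [Slepian], not asserted here.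
[cite: ConnesConsani2021, §4 eq. (prolateeq) p. 16 (arXiv chunk p0016:L19–23)] -/
def prolateLambda (φ : ℝ → ℝ) : ℝ :=
  (∫ v, φ v) / φ 0

/-- RH-FREE. CC's `ψ_n = P η_n = P 𝔽_{e_ℝ} ξ_n` (Prop. 4.5 (i), p0016:L50; `P` = multiplication by
`1_{|v| ≥ 1}`, §4 p0015:L42): the Fourier transform (Mathlib's `𝓕`, kernel `e^{−2πixy}` = CC's
`𝔽_{e_ℝ}`, eq. (13) p. 7) of the prolate function truncated to `[−1,1]`, cut off to `|v| ≥ 1`, as a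
function `ℝ → ℂ` built from the real prolate function `φ` (CC-normalised it is `√2` times this).
Prop. 4.5 (iii): the `ψ_n` are real valued, pairwise orthogonal, `‖ψ_n‖ = (1 − λ(n)²)^{1/2}`;
`ζ_n := (1 − λ(n)²)^{-1/2} ψ_n`.  By (prolateeq), `η_n = λ(n) ξ_n^{an}` (p0020:L80).
[cite: ConnesConsani2021, Prop. 4.5 (i) §4 p. 16 (arXiv chunk p0016:L50–59)] -/
def prolateCutFourier (φ : ℝ → ℝ) (v : ℝ) : ℂ :=
  if 1 ≤ |v| then 𝓕 (fun u : ℝ => (φ u : ℂ)) v else 0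

/-- RH-FREE. `ψ_n = Pη_n` vanishes inside `(−1, 1)`. [cite: ConnesConsani2021, Prop. 4.5 (i) §4 p. 16] -/
theorem prolateCutFourier_eq_zero_of_abs_lt_one (φ : ℝ → ℝ) {v : ℝ} (hv : |v| < 1) :
    prolateCutFourier φ v = 0 := by
  simp [prolateCutFourier, not_le.2 hv]

/-! ## The function `ε` of Theorem 4.7 (eq. (sonine0)), the density `ε ∘ exp`, and the density predicate -/

/-- RH-FREE. **The `n`-th term of (sonine0)** at `ρ = e^{y}` (`y ≥ 0`): `τ(n)⟨ξ_n | ϑ(ρ⁻¹) ζ_n⟩ =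
λ(n)(1 − λ(n)²)⁻¹ ⟨ξ_n | ϑ(e^{−y}) ψ_n⟩` (Thm. 4.7 p0018:L39 with `ζ_n = (1 − λ(n)²)^{-1/2}ψ_n`,
`τ(n) = λ(n)(1 − λ(n)²)^{-1/2}`, Prop. 4.5 (iii)–(iv)), written with the tree's matrix coefficient
`scalingCoeff ξ η τ = ⟨ξ|ϑ(e^τ)η⟩ = ∫ ξ̄(v) e^{−τ/2} η(e^{−τ}v) dv` (`ArchimedeanSoninTrace.lean`) at
`τ = −y`, i.e. `e^{y/2} ∫ φ(v) ψ_n(e^{y} v) dv`, for the real prolate function `φ = ψ_n^{tree}` (CC's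
`ξ_n = √2 φ`; CC's factor `½` in `⟨·|·⟩` (eq. (8) p. 7) cancels the two factors `√2`, and the term is
quadratic in `φ`, so its sign is immaterial). [cite: ConnesConsani2021, Thm. 4.7 eq. (sonine0) §4 p. 18 (arXiv chunk p0018:L37–40, L69)] -/
def epsTerm (φ : ℝ → ℝ) (y : ℝ) : ℂ :=
  ((prolateLambda φ / (1 - prolateLambda φ ^ 2) : ℝ) : ℂ) *
    scalingCoeff (fun v => (φ v : ℂ)) (prolateCutFourier φ) (-y)

/-- RH-FREE. **The density `ε ∘ exp` of CC's functional `E`** (§5 eq. (Eprime) p. 20: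
`E₊(f) := ∫ f(x) ε(exp|x|) dx`): `epsDensity ψ y := Σ'_n epsTerm (ψ n) |y| = ε(e^{|y|})` for a prolate
family `ψ : ℕ → ℝ → ℝ` (meant: `IsProlateFunction 1 (2n) (ψ n)`).  For `y ≥ 0` this is literally
(sonine0) at `ρ = e^{y} ≥ 1`; the `|y|` implements the printed symmetry `ε(ρ⁻¹) = ε(ρ)`.  This is the
`G` of hypothesis (H-ε) of `MainInequalityAssembly.lean` on `[0, ∞)`; as a function on `ℝ` it is NOT
`C²` at `0` (`ε′(1₊) ≃ 22.9965 ≠ 0`, Lemma 5.4), which is why the assembly is fed any `C²` function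
that agrees with it on `[0,∞)` (`IsArchDensity`).  Convergence of the series: App. F Lemma F.1 (49) (seat
t6; `tsum` convention immaterial there).  Real valued in print.
[cite: ConnesConsani2021, Thm. 4.7 eq. (sonine0) §4 p. 18 (arXiv chunk p0018:L37–40); §5 eq. (Eprime) p. 20 (p0020:L107–110)] -/
def epsDensity (ψ : ℕ → ℝ → ℝ) (y : ℝ) : ℂ :=
  ∑' n : ℕ, epsTerm (ψ n) |y|

/-- RH-FREE. **CC's function `ε` on `ℝ₊*`** (Thm. 4.7, p0018:L37–40): `ε(ρ) = epsDensity ψ (log ρ)`, so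
that for `ρ ≥ 1` it is the series (sonine0) and `ε(ρ⁻¹) = ε(ρ)` (`ccEpsilon_inv`); `ε(1) = 0`
(disjoint supports), and CC's `E(f) = ∫ f(ρ⁻¹)ε(ρ)d*ρ` (§5 eq. (Edefn) p. 19) is
`evenFunctional (epsDensity ψ) F` for the additive avatar `F = f ∘ exp` (`d*ρ = dx`).
[cite: ConnesConsani2021, Thm. 4.7 eq. (sonine0) §4 p. 18 (arXiv chunk p0018:L37–40)] -/
def ccEpsilon (ψ : ℕ → ℝ → ℝ) (ρ : ℝ) : ℂ :=
  epsDensity ψ (Real.log ρ)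

/-- RH-FREE. `ε(e^{−y}) = ε(e^{y})`: the density is even. [cite: ConnesConsani2021, Thm. 4.7 §4 p. 18 (arXiv chunk p0018:L37)] -/
theorem epsDensity_neg (ψ : ℕ → ℝ → ℝ) (y : ℝ) : epsDensity ψ (-y) = epsDensity ψ y := by
  simp only [epsDensity, abs_neg]

/-- RH-FREE. `epsDensity ψ |y| = epsDensity ψ y`: the density is the even function `G(|x|)` read by
`evenFunctional`. [cite: ConnesConsani2021, §5 eq. (Eprime) p. 20] -/
theorem epsDensity_abs (ψ : ℕ → ℝ → ℝ) (y : ℝ) : epsDensity ψ |y| = epsDensity ψ y := by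
  simp only [epsDensity, abs_abs]

/-- RH-FREE. The printed symmetry `ε(ρ⁻¹) = ε(ρ)` (Thm. 4.7, p0018:L37), by construction.
[cite: ConnesConsani2021, Thm. 4.7 §4 p. 18 (arXiv chunk p0018:L37)] -/
theorem ccEpsilon_inv (ψ : ℕ → ℝ → ℝ) (ρ : ℝ) : ccEpsilon ψ ρ⁻¹ = ccEpsilon ψ ρ := by
  simp only [ccEpsilon, Real.log_inv, epsDensity_neg]

/-- RH-FREE. For `ρ ≥ 1`, `ε(ρ)` IS the series (sonine0): `ε(ρ) = Σ'_n epsTerm (ψ n) (log ρ)`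
(no absolute value). [cite: ConnesConsani2021, Thm. 4.7 eq. (sonine0) §4 p. 18 (arXiv chunk p0018:L37–40)] -/
theorem ccEpsilon_of_one_le (ψ : ℕ → ℝ → ℝ) {ρ : ℝ} (hρ : 1 ≤ ρ) :
    ccEpsilon ψ ρ = ∑' n : ℕ, epsTerm (ψ n) (Real.log ρ) := by
  simp only [ccEpsilon, epsDensity, abs_of_nonneg (Real.log_nonneg hρ)]

/-- RH-FREE. **The archimedean density predicate** shared by the corpus items (H-TF)/(H-ε)/(H-op)
(route «ConnesConsaniSemilocal», items K0–K3): `G : ℝ → ℂ` agrees on `[0, ∞)` with `ε ∘ exp`, for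
every even prolate family (there is exactly one: `existsUnique_isProlateFunction_holds`, so the
universal quantifier is harmless and `IsArchDensity (epsDensity ψ)` holds — `isArchDensity_epsDensity`).
CC's `E = E₊` then reads `evenFunctional G` (`evenFunctional_congr_Ici`).
[cite: ConnesConsani2021, §5 eq. (Eprime) p. 20 (arXiv chunk p0020:L107–110); Thm. 4.7 §4 p. 18] -/
def IsArchDensity (G : ℝ → ℂ) : Prop :=
  ∀ ψ : ℕ → ℝ → ℝ, (∀ n, IsProlateFunction 1 (2 * n) (ψ n)) → ∀ x, 0 ≤ x → G x = epsDensity ψ x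

/-- RH-FREE. Two even prolate families coincide (uniqueness of `h_{2n,1}`,
`existsUnique_isProlateFunction_holds`). [cite: ConnesConsaniMoscovici2025, §7 eqs. (7.9)–(7.12)] -/
theorem prolateFamily_unique {ψ ψ' : ℕ → ℝ → ℝ} (hψ : ∀ n, IsProlateFunction 1 (2 * n) (ψ n))
    (hψ' : ∀ n, IsProlateFunction 1 (2 * n) (ψ' n)) : ψ = ψ' :=
  funext fun n =>
    (existsUnique_isProlateFunction_holds 1 one_pos (2 * n) (even_two_mul n)).unique (hψ n) (hψ' n)

/-- RH-FREE. Non-vacuity of the density predicate: `ε ∘ exp` itself (for THE prolate family) is an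
archimedean density. [cite: ConnesConsani2021, Thm. 4.7 §4 p. 18] -/
theorem isArchDensity_epsDensity {ψ : ℕ → ℝ → ℝ} (hψ : ∀ n, IsProlateFunction 1 (2 * n) (ψ n)) :
    IsArchDensity (epsDensity ψ) := by
  intro ψ' hψ' x _
  rw [prolateFamily_unique hψ hψ']

/-- RH-FREE. `evenFunctional` only reads its density on `[0, ∞)`: two densities that agree there give
the same functional (CC's `E₊(f) = ∫ f(x) ε(exp|x|) dx` depends on `ε ∘ exp` on `[0, ∞)` only).
[cite: ConnesConsani2021, §5 eq. (Eprime) p. 20 (arXiv chunk p0020:L107–110)] -/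
theorem evenFunctional_congr_Ici {G G' : ℝ → ℂ} (h : ∀ x, 0 ≤ x → G x = G' x) (F : ℝ → ℂ) :
    evenFunctional G F = evenFunctional G' F := by
  simp only [evenFunctional]
  refine integral_congr_ae (Eventually.of_forall fun x => ?_)
  simp only [h |x| (abs_nonneg x)]

/-- RH-FREE. For an archimedean density `G`, `E₊ = evenFunctional G = evenFunctional (epsDensity ψ)`.
[cite: ConnesConsani2021, §5 eq. (Eprime) p. 20] -/
theorem IsArchDensity.evenFunctional_eq {G : ℝ → ℂ} (hG : IsArchDensity G) {ψ : ℕ → ℝ → ℝ}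
    (hψ : ∀ n, IsProlateFunction 1 (2 * n) (ψ n)) (F : ℝ → ℂ) :
    evenFunctional G F = evenFunctional (epsDensity ψ) F :=
  evenFunctional_congr_Ici (hG ψ hψ) F

/-! ## Theorem 4.7 -/

/-- RH-FREE. **Connes–Consani 2021, Theorem 4.7 (= arXiv Thm. 27) — the archimedean trace formula, AS
PRINTED (strong form; NAMED FACT, no proof claimed).**  "Let `𝐒` be the orthogonal projection of
`L²(ℝ)_ev` on the closed subspace `S(1,1)`.  The following functional is positive:
`Tr(ϑ(f)𝐒) = W_∞(f) + ∫ f(ρ⁻¹)ε(ρ)d*ρ`, `f ∈ C_c^∞(ℝ₊*)`, where … `ε(ρ)` … is given for `ρ ≥ 1` by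
(sonine0)."  Typed (module docstring "How it is typed"): for every even prolate family `ψ`
(`IsProlateFunction 1 (2n) (ψ n)`, unique by `existsUnique_isProlateFunction_holds`) and every test
function `F = f ∘ exp` (`IsWeilTest F`), (i) for every Hilbert basis `b` of Sonin's space
`soninSpace 1 1 ⊆ L²(ℝ)` the diagonal coefficients `⟨b_i|ϑ(f)b_i⟩ = soninTraceForm F b_i` are summable
with sum `W_∞(f) + E(f) = archW F + evenFunctional (epsDensity ψ) F` (this is `Tr(𝐒ϑ(f)𝐒) =
Tr(ϑ(f)𝐒)`, the operator being trace class in print: Prop. 2.2 (iii) proof p. 10, Lemma D.1 (47), and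
`P𝒫̂P − 𝐒 = Σλ(n)²|ζ_n⟩⟨ζ_n|`), and (ii) positivity of the functional on the convolution algebra:
for `f = g ∗ g*` (`weilConv F (weilReflect F)`) the value `W_∞(f) + E(f)` is real and `≥ 0`.
Inputs of the printed proof: §2 (sch13) `W_∞(f) + ∫f(ρ⁻¹)δ(ρ)d*ρ = Tr(ϑ(f)P𝒫̂P)` (seat t1),
Prop. 4.5 / Rem. 4.6 (seat t3), the spectral decomposition (spectral) p0017:L61 with `R = 𝐒`.
[cite: ConnesConsani2021, Thm. 4.7 §4 p. 18 (arXiv item Thm. 27, chunk p0018:L33–40)] -/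
def CC2021_thm_4_7 : Prop :=
  ∀ ψ : ℕ → ℝ → ℝ, (∀ n, IsProlateFunction 1 (2 * n) (ψ n)) →
    ∀ F : ℝ → ℂ, IsWeilTest F →
      (∀ (ι : Type) (b : HilbertBasis ι ℂ (soninSpace 1 1)),
          HasSum (fun i => soninTraceForm F (((b i : soninSpace 1 1) : Lp ℂ 2 (volume : Measure ℝ)) : ℝ → ℂ))
            (archW F + evenFunctional (epsDensity ψ) F)) ∧
      (0 ≤ (archW (weilConv F (weilReflect F))
              + evenFunctional (epsDensity ψ) (weilConv F (weilReflect F))).re ∧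
        (archW (weilConv F (weilReflect F))
              + evenFunctional (epsDensity ψ) (weilConv F (weilReflect F))).im = 0)

/-- RH-FREE. **Connes–Consani 2021, Theorem 4.7 for `f = g ∗ g*`, WEAK-TRACE FORM (NAMED FACT, no
proof claimed)** — the shape of hypothesis (H-TF) of `MainInequalityAssembly.lean` (its use on p. 29,
proof of Thm. 6.11: "By Theorem 4.7 one has, for `f = g ∗ g*`, `Tr(ϑ(f)𝐒) = W_∞(f) + E(f)`") and of
route item K1 `SoninTraceFormula`: for every archimedean density `G` (`IsArchDensity`: `G = ε ∘ exp`
on `[0,∞)`), every test function `g` (additive avatar, ANY support) and every finite orthonormal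
family `ξ₁, …, ξ_n` of `L²(ℝ)` inside Sonin's space `S(1,1)`,
`Σ_i Re⟨ξ_i | ϑ(g ∗ g*) ξ_i⟩ ≤ Re W_∞(g ∗ g*) + Re E(g ∗ g*)` with `E = evenFunctional G` — every
partial sum of the trace of the positive operator `𝐒ϑ(g)ϑ(g)*𝐒` is at most its trace
`Tr(ϑ(g ∗ g*)𝐒)`.  A COROLLARY of `CC2021_thm_4_7` (positivity `⟨ξ|ϑ(g ∗ g*)ξ⟩ = ‖ϑ(g)*ξ‖²
≥ 0` and comparison of partial sums with the sum over an orthonormal basis of `S(1,1)`), PROVED as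
`CC2021_thm_4_7_weak_of_thm_4_7`; kept as a named `Prop` because it is the text of route item K1
(FACT-LIST: `CC2021_thm_4_7_weak ⇐ CC2021_thm_4_7`, proved).  Fed to the assembly by
`hTr_of_thm_4_7_weak`. [cite: ConnesConsani2021, Thm. 4.7 §4 p. 18 (arXiv chunk p0018:L33–40); Thm. 6.11 proof §6.7 p. 29] -/
def CC2021_thm_4_7_weak : Prop :=
  ∀ G : ℝ → ℂ, IsArchDensity G →
    ∀ g : ℝ → ℂ, IsWeilTest g →
      ∀ (n : ℕ) (ξ : Fin n → Lp ℂ 2 (volume : Measure ℝ)),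
        Orthonormal ℂ ξ → (∀ i, ξ i ∈ soninSpace 1 1) →
          ∑ i, (soninTraceForm (weilConv g (weilReflect g)) (ξ i : ℝ → ℂ)).re
            ≤ (archW (weilConv g (weilReflect g))).re
              + (evenFunctional G (weilConv g (weilReflect g))).re

/-- RH-FREE. **The (H-TF) binder of `MainInequalityAssembly`, verbatim, from the weak Theorem 4.7** for
ANY archimedean density `G` (the assembly's `G ∈ C²(ℝ)` is such an extension of `ε ∘ exp|_{[0,∞)}`;
`evenFunctional` only reads `G(|x|)`); the support hypothesis of the binder is simply dropped.  This is
the adapter through which `weilArchPositivity_soninTrace_fine_of_spectralData` / `…_of_opIneq` consume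
Theorem 4.7. [cite: ConnesConsani2021, Thm. 4.7 §4 p. 18; Thm. 6.11 proof §6.7 p. 29] -/
theorem hTr_of_thm_4_7_weak (h : CC2021_thm_4_7_weak) {G : ℝ → ℂ} (hG : IsArchDensity G) :
    ∀ g : ℝ → ℂ, IsWeilTest g → tsupport g ⊆ Icc (-(Real.log 2 / 2)) (Real.log 2 / 2) →
      ∀ (n : ℕ) (ξ : Fin n → Lp ℂ 2 (volume : Measure ℝ)),
        Orthonormal ℂ ξ → (∀ i, ξ i ∈ soninSpace 1 1) →
          ∑ i, (soninTraceForm (weilConv g (weilReflect g)) (ξ i : ℝ → ℂ)).re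
            ≤ (archW (weilConv g (weilReflect g))).re
              + (evenFunctional G (weilConv g (weilReflect g))).re :=
  fun g hg _ n ξ hξ hS => h G hG g hg n ξ hξ hS

/-- RH-FREE. The weak form instantiated at THE prolate family's own density `ε ∘ exp`.
[cite: ConnesConsani2021, Thm. 4.7 §4 p. 18 (arXiv chunk p0018:L33–40)] -/
theorem CC2021_thm_4_7_weak.epsDensity (h : CC2021_thm_4_7_weak) {ψ : ℕ → ℝ → ℝ}
    (hψ : ∀ n, IsProlateFunction 1 (2 * n) (ψ n)) {g : ℝ → ℂ} (hg : IsWeilTest g)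
    {n : ℕ} {ξ : Fin n → Lp ℂ 2 (volume : Measure ℝ)} (hξ : Orthonormal ℂ ξ)
    (hS : ∀ i, ξ i ∈ soninSpace 1 1) :
    ∑ i, (soninTraceForm (weilConv g (weilReflect g)) (ξ i : ℝ → ℂ)).re
      ≤ (archW (weilConv g (weilReflect g))).re
        + (evenFunctional (epsDensity ψ) (weilConv g (weilReflect g))).re :=
  h _ (isArchDensity_epsDensity hψ) g hg n ξ hξ hS

/-- RH-FREE. **WEAK ⇐ STRONG: the weak-trace form of Theorem 4.7 follows from Theorem 4.7 as
printed** ("How the trace is typed", `ArchimedeanSoninTrace.lean`: for `f = g ∗ g*` each diagonal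
coefficient `⟨e|ϑ(f)e⟩ = ‖ϑ(g)*e‖² ≥ 0`, so every finite orthonormal family of the closed subspace
`S(1,1)` has partial sum at most the trace over any orthonormal basis of `S(1,1)`).  PROVED from the
tree's `ScalingOperator.lean` (`ϑ(g)` as an operator, `re_soninTraceForm_autocorr`) and
`HilbertSchmidtPartialSums.sum_norm_sq_apply_le_of_hasSum` (Reed–Simon I Thm. VI.18), with the prolate
family supplied by `existsUnique_isProlateFunction_holds` and a Hilbert basis of `soninSpace 1 1`
(`completeSpace_soninSpace`).  Hence the cell's frozen boundary for binder (A) is Theorem 4.7 itself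
(`CC2021_thm_4_7`), not a second fact. [cite: ConnesConsani2021, Thm. 4.7 §4 p. 18 (arXiv chunk p0018:L33–40); Cor. 2.3 (i) proof p. 11] -/
theorem CC2021_thm_4_7_weak_of_thm_4_7 (h : CC2021_thm_4_7) : CC2021_thm_4_7_weak := by
  intro G hG g hg n ξ hξ hS
  -- THE even prolate family (Slepian; tree: existence and uniqueness)
  choose ψ hψ using fun k : ℕ =>
    (existsUnique_isProlateFunction_holds 1 one_pos (2 * k) (even_two_mul k)).exists
  have hF : IsWeilTest (weilConv g (weilReflect g)) := hg.weilConv hg.weilReflect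
  have hgi : Integrable g := hg.1.continuous.integrable_of_hasCompactSupport hg.2
  -- an orthonormal basis of Sonin's space and the trace over it (Theorem 4.7, strong form)
  obtain ⟨w, b, -⟩ := exists_hilbertBasis ℂ (soninSpace 1 1)
  have H := (h ψ hψ _ hF).1 w b
  -- every diagonal coefficient is `‖ϑ(g)* b_i‖²`
  have H' : HasSum (fun i : w => ‖ContinuousLinearMap.adjoint (scalingOp g)
      ((b i : soninSpace 1 1) : Lp ℂ 2 (volume : Measure ℝ))‖ ^ 2)
      (archW (weilConv g (weilReflect g))
        + evenFunctional (epsDensity ψ) (weilConv g (weilReflect g))).re := by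
    have H1 := Complex.hasSum_re H
    refine H1.congr_fun fun i => ?_
    exact (re_soninTraceForm_autocorr hgi _).symm
  have hle := Literature.Analysis.OperatorTheory.sum_norm_sq_apply_le_of_hasSum
    (V := soninSpace 1 1) b (ContinuousLinearMap.adjoint (scalingOp g)) H' hξ hS Finset.univ
  rw [sum_re_soninTraceForm_autocorr_eq hgi, hG.evenFunctional_eq hψ, ← Complex.add_re]
  exact hle

/-- RH-FREE. **Eq. (4) = `WeilArchPositivity_soninTrace_fine` from the WEAK Theorem 4.7 and the two
other printed inputs** — the composition check at current bytes of `MainInequalityAssembly`: (A) the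
named fact `CC2021_thm_4_7_weak`; (B) a `C²` archimedean density `G` (agreeing with `ε ∘ exp` on
`[0, ∞)`) with `G′(0) = e′ > 0` (Lemma 5.2 / Prop. 5.3 / Lemma 5.4: `e′ = ε′(1₊) ≃ 22.9965`); (C) the
§6 spectral data of a symmetric finite-rank `T` on `L²(I)`, `I = [−½log 2, ½log 2]` (Lemma 6.4,
Fact 6.5, Lemma 6.8 (iii), Fact 6.1/Lemma 6.3, Lemma 6.9: floating point in print) and the arithmetic
`8a₀e′/log 2 < 17` (`printedConstants_mainInequality`).  RH-FREE; NOT RH-detecting.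
[cite: ConnesConsani2021, eq. (4) p. 4; Thm. 6.11 §6.7 pp. 28–29] -/
theorem weilArchPositivity_soninTrace_fine_of_thm_4_7_weak (h : CC2021_thm_4_7_weak)
    {G : ℝ → ℂ} (hGa : IsArchDensity G)
    {T : Lp ℂ 2 (volume.restrict (Icc (-(Real.log 2 / 2)) (Real.log 2 / 2))) →L[ℂ]
      Lp ℂ 2 (volume.restrict (Icc (-(Real.log 2 / 2)) (Real.log 2 / 2)))}
    {η : Lp ℂ 2 (volume.restrict (Icc (-(Real.log 2 / 2)) (Real.log 2 / 2)))}
    {lmax l₂ a₀ ε₁ e' : ℝ} (hG : ContDiff ℝ 2 G) (hGe : deriv G 0 = e') (he' : 0 < e')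
    (hη : ‖η‖ = 1) (hlmax : 1 ≤ lmax) (hl₂ : l₂ ≤ 1) (ha₀ : 0 ≤ a₀)
    (hsa : ∀ x y : Lp ℂ 2 (volume.restrict (Icc (-(Real.log 2 / 2)) (Real.log 2 / 2))),
      ⟪T x, y⟫_ℂ = ⟪x, T y⟫_ℂ) (heig : T η = ((lmax : ℝ) : ℂ) • η)
    (hTl₂ : ∀ ζ : Lp ℂ 2 (volume.restrict (Icc (-(Real.log 2 / 2)) (Real.log 2 / 2))),
      ⟪η, ζ⟫_ℂ = 0 → RCLike.re ⟪ζ, T ζ⟫_ℂ ≤ l₂ * ‖ζ‖ ^ 2)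
    (hKT : ‖windowOp (-(Real.log 2 / 2)) (Real.log 2 / 2) (integrableOn_varpi hG _ _) - T‖ ≤ ε₁)
    (hε : ε₁ ≤ rankOneGap a₀ (lmax - 1) (1 - l₂) ‖⟪η, constVector (-(Real.log 2 / 2)) (Real.log 2 / 2)⟫_ℂ‖)
    (hc : 8 * a₀ * e' / Real.log 2 < 17) :
    WeilArchPositivity_soninTrace_fine :=
  weilArchPositivity_soninTrace_fine_of_spectralData hG hGe he' hη hlmax hl₂ ha₀ hsa heig hTl₂ hKT
    hε hc (hTr_of_thm_4_7_weak h hGa)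

/-- RH-FREE. **Eq. (4) from the WEAK Theorem 4.7, a `C²` archimedean density with `G′(0) = e′ > 0`, the
SIGN-FREE operator inequality (H-op) on `L²(I)` and `8a₀e′/log 2 < 17`** — the shape of the route's
`closes` (items K0–K3) via `weilArchPositivity_soninTrace_fine_of_opIneq`.  RH-FREE; NOT RH-detecting.
[cite: ConnesConsani2021, eq. (4) p. 4; Thm. 6.11 §6.7 pp. 28–29; Lemma 6.10 p. 28] -/
theorem weilArchPositivity_soninTrace_fine_of_thm_4_7_weak_of_opIneq (h : CC2021_thm_4_7_weak)
    {G : ℝ → ℂ} (hGa : IsArchDensity G) {a₀ e' : ℝ}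
    (hG : ContDiff ℝ 2 G) (hGe : deriv G 0 = e') (he' : 0 < e')
    (hpos : ∀ ξ : Lp ℂ 2 (volume.restrict (Icc (-(Real.log 2 / 2)) (Real.log 2 / 2))),
      0 ≤ RCLike.re ⟪ξ, ξ - windowOp (-(Real.log 2 / 2)) (Real.log 2 / 2) (integrableOn_varpi hG _ _) ξ⟫_ℂ
            + a₀ * ‖⟪constVector (-(Real.log 2 / 2)) (Real.log 2 / 2), ξ⟫_ℂ‖ ^ 2)
    (hc : 8 * a₀ * e' / Real.log 2 < 17) :
    WeilArchPositivity_soninTrace_fine :=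
  weilArchPositivity_soninTrace_fine_of_opIneq hG hGe he' hpos hc (hTr_of_thm_4_7_weak h hGa)

/-- RH-FREE. **Theorem 1 = `WeilArchPositivity_soninTrace` from the WEAK Theorem 4.7, a `C²`
archimedean density with `G′(0) > 0`, and the sign-free operator inequality (H-op)** (via
`weilArchPositivity_soninTrace_of_opIneq`).  RH-FREE; NOT RH-detecting.
[cite: ConnesConsani2021, Thm. 1 (Intro p. 4); Thm. 6.11 §6.7 pp. 28–29] -/
theorem weilArchPositivity_soninTrace_of_thm_4_7_weak (h : CC2021_thm_4_7_weak)
    {G : ℝ → ℂ} (hGa : IsArchDensity G) {a₀ e' : ℝ}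
    (hG : ContDiff ℝ 2 G) (hGe : deriv G 0 = e') (he' : 0 < e')
    (hpos : ∀ ξ : Lp ℂ 2 (volume.restrict (Icc (-(Real.log 2 / 2)) (Real.log 2 / 2))),
      0 ≤ RCLike.re ⟪ξ, ξ - windowOp (-(Real.log 2 / 2)) (Real.log 2 / 2) (integrableOn_varpi hG _ _) ξ⟫_ℂ
            + a₀ * ‖⟪constVector (-(Real.log 2 / 2)) (Real.log 2 / 2), ξ⟫_ℂ‖ ^ 2) :
    WeilArchPositivity_soninTrace :=
  weilArchPositivity_soninTrace_of_opIneq hG hGe he' hpos (hTr_of_thm_4_7_weak h hGa)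

/-! ## App. D, Lemma D.1 (arXiv Lemma 47): the quantized differential `[H, f]` is of infinite order -/

section SNumbers

variable {𝕜 : Type*} [RCLike 𝕜] {E : Type*} [NormedAddCommGroup E] [NormedSpace 𝕜 E]

/-- RH-FREE. The `n`-th **approximation number** of a bounded operator, `a_n(T) = inf {‖T − F‖ : rank F ≤ n}`
(`n = 0, 1, …`; `a_0(T) = ‖T‖`).  On a Hilbert space these are the singular values / characteristic
values `μ_n(T)` of a compact `T` (Pietsch; Gohberg–Krein Ch. II §2: `s_{n+1}(T) = min{‖T − K‖ :
rank K ≤ n}`), the numbers whose decay App. D speaks of ("characteristic values", p0033:L20).  Minimal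
vocabulary for Lemma D.1 (47); the rank condition is stated with `Module.rank` (no junk for
infinite rank). [folklore] -/
def approxNumber (T : E →L[𝕜] E) (n : ℕ) : ℝ :=
  sInf {r : ℝ | ∃ F : E →L[𝕜] E, Module.rank 𝕜 (LinearMap.range (F : E →ₗ[𝕜] E)) ≤ n ∧ ‖T - F‖ = r}

/-- RH-FREE. **Infinitesimal of infinite order** (Connes, quantized calculus; App. D p0033:L20: "a compact
operator has infinite order when its characteristic values form a sequence of rapid decay"):
`a_n(T) = O(n^{−k})` for every `k` (Simon, *Trace ideals*, for the singular values).
[cite: ConnesConsani2021, App. D p. 33 (arXiv chunk p0033:L20)] -/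
def IsInfiniteOrder (T : E →L[𝕜] E) : Prop :=
  ∀ k : ℕ, ∃ C : ℝ, ∀ n : ℕ, approxNumber T n * ((n : ℝ) + 1) ^ k ≤ C

/-- RH-FREE. **Trace class** in s-number form: `Σ_n a_n(T) < ∞` (on Hilbert space: the Schatten class `𝓛¹`,
since the approximation numbers are the singular values; Simon, *Trace ideals*).
[cite: ConnesConsani2021, App. D p. 33 (arXiv chunk p0033:L20)] -/
def IsTraceClass (T : E →L[𝕜] E) : Prop :=
  Summable (approxNumber T)

/-- RH-FREE. The set in the definition of `approxNumber` is nonempty (`F = 0`) and bounded below by `0`.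
[folklore] -/
private theorem approxNumber_nonneg (T : E →L[𝕜] E) (n : ℕ) : 0 ≤ approxNumber T n := by
  unfold approxNumber
  refine Real.sInf_nonneg ?_
  rintro r ⟨F, -, rfl⟩
  exact norm_nonneg _

/-- RH-FREE. `a_n(T) ≤ ‖T‖` (take `F = 0`): the defining set is nonempty. [folklore] -/
private theorem approxNumber_le_norm (T : E →L[𝕜] E) (n : ℕ) : approxNumber T n ≤ ‖T‖ := by
  unfold approxNumber
  refine csInf_le ⟨0, ?_⟩ ⟨0, ?_, by rw [sub_zero]⟩
  · rintro r ⟨F, -, rfl⟩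
    exact norm_nonneg _
  · have h : LinearMap.range ((0 : E →L[𝕜] E) : E →ₗ[𝕜] E) = ⊥ := by
      rw [ContinuousLinearMap.toLinearMap_zero, LinearMap.range_zero]
    rw [h, rank_bot]
    exact zero_le

/-- RH-FREE. "this implies that it is of trace class" (App. D p0033:L20): rapid decay of the approximation
numbers (already `a_n ≤ C (n+1)^{-2}`) makes them summable. [cite: ConnesConsani2021, App. D p. 33 (arXiv chunk p0033:L20)] -/
theorem IsInfiniteOrder.isTraceClass {T : E →L[𝕜] E} (h : IsInfiniteOrder T) : IsTraceClass T := by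
  obtain ⟨C, hC⟩ := h 2
  have hsum : Summable fun n : ℕ => C * (((n : ℝ) + 1) ^ 2)⁻¹ := by
    have := (summable_nat_add_iff 1).2 (Real.summable_one_div_nat_pow.2 one_lt_two)
    refine (this.mul_left C).congr fun n => ?_
    simp [one_div, Nat.cast_add, Nat.cast_one]
  refine Summable.of_nonneg_of_le (fun n => approxNumber_nonneg T n) (fun n => ?_) hsum
  have hpos : 0 < ((n : ℝ) + 1) ^ 2 := by positivity
  rw [← div_eq_mul_inv, le_div_iff₀ hpos]
  exact hC n

end SNumbers

/-- RH-FREE. **The Schwartz kernel of the quantized differential** (App. E eq. (quantdiff), p0034:L21–22: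
"The quantized differential `đf` of `f` is given by the kernel `k(s,t) = (i/π)(f(s) − f(t))/(s − t)`";
Rem. D.2 (48), p0033:L39–41, second alternate proof of Lemma D.1 (47): "estimate directly, for `f ∈ 𝒮(ℝ)`, the
Schwartz kernel given by `k(x,y) = (f(x) − f(y))/(x − y)`").  Here `H = 2𝔽_C 1_P 𝔽_C⁻¹ − 1` on
`L²(Ĉ) ≅ L²(ℝ)` (`C = ℝ₊*`, `P = {|u| ≥ 1}`, bicharacter `e^{−ist}`, App. D p0033:L3–20) and
`đf = [H, f]` for `f` acting by multiplication.  On the diagonal `s = t` (a null set of `ℝ²`,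
immaterial for the `L²` kernel) Lean's value is `0`; the continuous value would be `(i/π) f′(s)`.
[cite: ConnesConsani2021, App. E eq. (quantdiff) p. 34 (arXiv chunk p0034:L21–22)] -/
def quantizedDiffKernel (f : ℝ → ℂ) (s t : ℝ) : ℂ :=
  I / π * ((f s - f t) / ((s : ℂ) - t))

/-- RH-FREE. The kernel is symmetric: `k(t, s) = k(s, t)`. [cite: ConnesConsani2021, App. E eq. (quantdiff) p. 34] -/
theorem quantizedDiffKernel_symm (f : ℝ → ℂ) (s t : ℝ) :
    quantizedDiffKernel f t s = quantizedDiffKernel f s t := by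
  simp only [quantizedDiffKernel]
  rw [← neg_sub (f s) (f t), ← neg_sub (s : ℂ) t, neg_div_neg_eq]

/-- RH-FREE. **Connes–Consani 2021, App. D Lemma D.1 = arXiv Lemma 47 (NAMED FACT, no proof claimed).**  "For `f ∈ 𝒮(Ĉ)` the
quantized differential `[H, f]` is an infinitesimal of infinite order and in particular a trace class
operator."  Typed on the printed kernel of `[H, f]` (App. E (quantdiff), `quantizedDiffKernel`), in the
tree's kernel-operator idiom (no operator is chosen): for every Schwartz function `f` on `ℝ ≅ Ĉ`, the
kernel `k_f(s,t) = (i/π)(f(s) − f(t))/(s − t)` is square integrable on `ℝ²` (so that a bounded — indeed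
Hilbert–Schmidt — operator with this kernel exists), and EVERY bounded operator `A` on `L²(ℝ)` with
`(Aφ)(s) = ∫ k_f(s,t) φ(t) dt` a.e. is of infinite order (`IsInfiniteOrder`: approximation numbers
of rapid decay); "in particular trace class" is then `IsInfiniteOrder.isTraceClass`.  Printed proof:
reduce to `PK(1−P)` for the convolution operator `K = 𝔽_C⁻¹ f 𝔽_C`, smooth cut-off `φ`, and bound
`AⁿT` for the harmonic oscillator `A = −∂² + x²` (p0033:L24–36); Rem. D.2 (48) gives two alternate proofs
(conformal map `L²(S¹) → L²(ℝ)` conjugating `H` to `2P_{H²} − 1`, or the direct kernel estimate).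
Used in the proof of Prop. 2.2 (iii) (p0010:L76: "`[P, ϑ(f)]` is of trace class") and hence of
Thm. 4.7.  General theory: [Co-book] = Connes, *Noncommutative Geometry* (1994), Ch. IV.
[cite: ConnesConsani2021, App. D Lemma D.1 p. 33 (= arXiv:2006.13771 Lemma 47, chunk p0033:L22)] -/
def CC2021_lemma_D47 : Prop :=
  ∀ f : SchwartzMap ℝ ℂ,
    MemLp (Function.uncurry (quantizedDiffKernel f)) 2 ((volume : Measure ℝ).prod volume) ∧
      ∀ A : Lp ℂ 2 (volume : Measure ℝ) →L[ℂ] Lp ℂ 2 (volume : Measure ℝ),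
        (∀ φ : Lp ℂ 2 (volume : Measure ℝ),
            (A φ : ℝ → ℂ) =ᵐ[volume] fun s => ∫ t, quantizedDiffKernel f s t * (φ : ℝ → ℂ) t) →
          IsInfiniteOrder A

/-- RH-FREE. "… and in particular a trace class operator" (Lemma D.1 (47), second clause) — PROVED from the first
clause via `IsInfiniteOrder.isTraceClass`. [cite: ConnesConsani2021, App. D Lemma D.1 p. 33 (= arXiv Lemma 47, chunk p0033:L22)] -/
theorem CC2021_lemma_D47.isTraceClass (h : CC2021_lemma_D47) (f : SchwartzMap ℝ ℂ)
    (A : Lp ℂ 2 (volume : Measure ℝ) →L[ℂ] Lp ℂ 2 (volume : Measure ℝ))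
    (hA : ∀ φ : Lp ℂ 2 (volume : Measure ℝ),
      (A φ : ℝ → ℂ) =ᵐ[volume] fun s => ∫ t, quantizedDiffKernel f s t * (φ : ℝ → ℂ) t) :
    IsTraceClass A :=
  ((h f).2 A hA).isTraceClass

end Literature.NumberTheory.ConnesConsani2021

end
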